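import Literature.NumberTheory.Automorphic.MeyerArchOrbit
import Literature.NumberTheory.Automorphic.MeyerFiniteIdeleUnits
import Literature.NumberTheory.Automorphic.MirabolicEisensteinMajorant
import Literature.NumberTheory.Automorphic.IdelicDyadicUnfolding
import Literature.NumberTheory.Automorphic.AdelicRationalVectorCount
import Literature.Analysis.Calculus.LocalizedSmoothSeries
import HarnessLib

/-!
# Meyer's Lemma 5.3: the summation map sends `𝒮(𝔸_K)` into `𝒮(C_K)_{(1,∞)}`

Topic `NumberTheory/Automorphic`; namespace `Literature.NumberTheory.Automorphic.Meyer`. Proof file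
(theorems only) for R. Meyer, *On a representation of the idele class group related to primes and
zeros of L-functions*, Duke Math. J. 127 (2005), Lemma 5.3 [Meyer2005]: for a Bruhat–Schwartz
function `f` on the adele ring the theta-type sum `Σ f (x) = ∑_{a ∈ Kˣ} f(a x)` (`Meyer.meyerSum`)
lies in the weighted Bruhat–Schwartz space `𝒮(C_K)_{(1,∞)}` of the idele class group
(`Meyer.ideleClassSchwartzWeighted K (Set.Ioi 1)`): for every `α > 1`, `Σ f · |x|^α ∈ 𝒮(C_K)`
(`meyerSum_mem_ideleClassSchwartzWeighted_Ioi`).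

Meyer deduces this from his Theorem 5.1 (derived coinvariant spaces and the `S`-local theory).
Here it is proved directly from the theta-series estimates of the tree, through the criterion
`weightMul_mem_ideleClassSchwartz_of_bounds` of `MeyerArchOrbit`:

* `exists_norm_iteratedFDeriv_schwartz_mul_exp_le` — for a Schwartz function `Φ` on
  `(K ⊗ ℝ)^{Fin 1}` the derivatives in `X` of `X ↦ Φ(z · exp X)` on the unit ball decay faster than
  any power of `‖z‖` (Faà di Bruno, `norm_iteratedFDeriv_comp_le`, and the Schwartz seminorms);
* for a pure tensor `f = Φ_∞ ⊗ Φ_f` the orbit map `X ↦ Σ f(x exp X)` is the series over `a ∈ Kˣ` of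
  `Φ_f((a x)_f) Φ_∞((a x)_∞ exp X)`; by the localized `contDiff_tsum` of
  `Literature.Analysis.Calculus.LocalizedSmoothSeries` it is smooth at `0` with
  `‖∂ⁿ_X Σf(x exp X)|₀‖ ≤ ∑_{a} |Φ_f((ax)_f)| C (1 + ‖(ax)_∞‖)^{-k}`
  (`contDiffAt_archOrbit_meyerSum_tensor`, `norm_iteratedFDeriv_archOrbit_meyerSum_tensor_le`);
* the right-hand side is `O(|x|^{-θ/[K:ℚ]})` for every `[K:ℚ] < θ ≤ k`, uniformly on `C_K`
  (`exists_tsum_decay_le_rpow_ideleNorm`): on the dyadic sets of representatives `Y_r` of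
  `IdelicDyadicUnfolding` this is `exists_tsum_enorm_smul_le_of_decay` of
  `MirabolicEisensteinMajorant` (`n = 1`, `g = 1`) with the lattice sums of
  `tsum_norm_vecInfinitePart_rpow_neg_lt_top`, and every idele is `k · y`, `k ∈ Kˣ`, `y ∈ Y_r`
  (`exists_principalIdele_mul_mem_dyadicIdeleSet`), the sum being `Kˣ`-invariant;
* `exists_openSubgroup_forall_comp_mul_eq` — a locally constant compactly supported `Φ_f` on
  `(𝔸_K^∞)^{Fin 1}` is invariant under an open subgroup of `(𝔸_K^∞)ˣ` (compactness), which may be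
  taken inside `𝒪̂ˣ` (open, `isOpen_integralFiniteUnits`), where the idele norm is `1`
  (`classNorm_finiteUnitClass` of `MeyerFiniteIdeleUnits`);
* linearity in `f` (span induction over `piSchwartzBruhat K (Fin 1)`).

## References

* R. Meyer, Duke Math. J. 127 (2005), §5.3, Lemma 5.3 [Meyer2005].
* R. Godement, H. Jacquet, *Zeta functions of simple algebras*, LNM 260 (1972), §11 (theta series
  estimates) [GodementJacquetLNM260].
-/

noncomputable section

open MeasureTheory NumberField NumberField.InfinitePlace NumberField.mixedEmbedding IsDedekindDomain
  Filter Set Metric Matrix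
open scoped NNReal ENNReal ContDiff Topology Classical

namespace Literature.NumberTheory.Automorphic.Meyer

variable (K : Type) [Field K] [NumberField K]

/-! ### Derivatives of `X ↦ Φ(z · exp X)` for a Schwartz function `Φ` -/

section OrbDeriv

/-- The constant-vector exponential `X ↦ (exp X)_{i}` on `(K ⊗ ℝ)^{Fin 1}` is smooth. [folklore] -/
theorem contDiff_const_mixedExpUnit_val {n : WithTop ℕ∞} :
    ContDiff ℝ n fun X : mixedSpace K =>
      (fun _ : Fin 1 => ((mixedExpUnit K X : (mixedSpace K)ˣ) : mixedSpace K)) :=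
  contDiff_pi.2 fun _ => contDiff_mixedExpUnit_val K

/-- `‖exp Y‖ ≤ e^{‖Y‖}` for the componentwise exponential of `K ⊗ ℝ` (sup norms). [folklore] -/
theorem norm_mixedExpUnit_val_le (Y : mixedSpace K) :
    ‖((mixedExpUnit K Y : (mixedSpace K)ˣ) : mixedSpace K)‖ ≤ Real.exp ‖Y‖ := by
  rw [mixedExpUnit_val, Prod.norm_def]
  refine max_le ?_ ?_
  · refine (pi_norm_le_iff_of_nonneg (Real.exp_pos _).le).2 fun w => ?_
    rw [Real.norm_eq_abs, Real.abs_exp]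
    refine Real.exp_le_exp.2 ((le_abs_self _).trans ?_)
    rw [← Real.norm_eq_abs]
    exact (norm_le_pi_norm Y.1 w).trans (norm_fst_le Y)
  · refine (pi_norm_le_iff_of_nonneg (Real.exp_pos _).le).2 fun w => ?_
    rw [Complex.norm_exp]
    refine Real.exp_le_exp.2 ((le_abs_self _).trans ((Complex.abs_re_le_norm _).trans ?_))
    exact (norm_le_pi_norm Y.2 w).trans (norm_snd_le Y)

/-- `‖(exp Y)_i‖ ≤ e^{‖Y‖}` for the constant vector. [folklore] -/
theorem norm_const_mixedExpUnit_val_le (Y : mixedSpace K) :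
    ‖(fun _ : Fin 1 => ((mixedExpUnit K Y : (mixedSpace K)ˣ) : mixedSpace K))‖ ≤ Real.exp ‖Y‖ :=
  (pi_norm_const_le _).trans (norm_mixedExpUnit_val_le K Y)

/-- `z = (z · exp X) · exp(-X)`, whence `‖z‖ ≤ ‖z · exp X‖ · e^{‖X‖}`. [folklore] -/
theorem norm_le_norm_mul_exp_mul (z : Fin 1 → mixedSpace K) (X : mixedSpace K) :
    ‖z‖ ≤ ‖z * fun _ : Fin 1 => ((mixedExpUnit K X : (mixedSpace K)ˣ) : mixedSpace K)‖ *
      Real.exp ‖X‖ := by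
  have hz : z = (z * fun _ : Fin 1 => ((mixedExpUnit K X : (mixedSpace K)ˣ) : mixedSpace K)) *
      fun _ : Fin 1 => ((mixedExpUnit K (-X) : (mixedSpace K)ˣ) : mixedSpace K) := by
    rw [mul_assoc]
    have h1 : ((fun _ : Fin 1 => ((mixedExpUnit K X : (mixedSpace K)ˣ) : mixedSpace K)) *
        fun _ : Fin 1 => ((mixedExpUnit K (-X) : (mixedSpace K)ˣ) : mixedSpace K)) = 1 := by
      funext i
      rw [Pi.mul_apply, Pi.one_apply, ← Units.val_mul, ← mixedExpUnit_add, add_neg_cancel,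
        mixedExpUnit_zero, Units.val_one]
    rw [h1, mul_one]
  calc ‖z‖ = ‖(z * fun _ : Fin 1 => ((mixedExpUnit K X : (mixedSpace K)ˣ) : mixedSpace K)) *
        fun _ : Fin 1 => ((mixedExpUnit K (-X) : (mixedSpace K)ˣ) : mixedSpace K)‖ := by rw [← hz]
    _ ≤ ‖z * fun _ : Fin 1 => ((mixedExpUnit K X : (mixedSpace K)ˣ) : mixedSpace K)‖ *
        ‖fun _ : Fin 1 => ((mixedExpUnit K (-X) : (mixedSpace K)ˣ) : mixedSpace K)‖ := norm_mul_le _ _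
    _ ≤ _ := mul_le_mul_of_nonneg_left ((norm_const_mixedExpUnit_val_le K (-X)).trans
        (by rw [norm_neg])) (norm_nonneg _)

/-- **Derivatives of `X ↦ Φ(z · exp X)` decay in `z`.** For a Schwartz function `Φ` on
`(K ⊗ ℝ)^{Fin 1}` and `n, k ∈ ℕ` there is `C ≥ 0` such that for all `z` and all `‖X‖ ≤ 1`,
`‖∂ⁿ_X Φ(z · exp X)‖ ≤ C (1 + ‖z‖)^{-k}` (the chain rule bound `norm_iteratedFDeriv_comp_le` with
the Schwartz decay of the derivatives of `Φ` at `z exp X`, whose norm is `≥ e⁻¹ ‖z‖`). [folklore] -/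
theorem exists_norm_iteratedFDeriv_schwartz_mul_exp_le (Φ : SchwartzMap (Fin 1 → mixedSpace K) ℂ)
    (n k : ℕ) :
    ∃ C : ℝ, 0 ≤ C ∧ ∀ (z : Fin 1 → mixedSpace K) (X : mixedSpace K), ‖X‖ ≤ 1 →
      ‖iteratedFDeriv ℝ n (fun Y : mixedSpace K =>
          Φ (z * fun _ : Fin 1 => ((mixedExpUnit K Y : (mixedSpace K)ˣ) : mixedSpace K))) X‖ ≤
        C * (1 + ‖z‖) ^ (-(k : ℝ)) := by
  -- the exponential vector `E` and bounds for its derivatives on the unit ball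
  obtain ⟨E, hE⟩ : ∃ E : mixedSpace K → (Fin 1 → mixedSpace K), E = fun Y _ =>
    ((mixedExpUnit K Y : (mixedSpace K)ˣ) : mixedSpace K) := ⟨_, rfl⟩
  have hEs : ContDiff ℝ ∞ E := by rw [hE]; exact contDiff_const_mixedExpUnit_val K
  have hB : ∀ i : ℕ, ∃ B : ℝ, 0 ≤ B ∧ ∀ X : mixedSpace K, ‖X‖ ≤ 1 → ‖iteratedFDeriv ℝ i E X‖ ≤ B := by
    intro i
    have hc : Continuous (iteratedFDeriv ℝ i E) :=
      hEs.continuous_iteratedFDeriv (by exact_mod_cast le_top)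
    obtain ⟨B, hB⟩ := (isCompact_closedBall (0 : mixedSpace K) 1).exists_bound_of_continuousOn
      hc.continuousOn
    refine ⟨max B 0, le_max_right _ _, fun X hX => (hB X ?_).trans (le_max_left _ _)⟩
    rwa [mem_closedBall, dist_zero_right]
  choose B hB0 hB using hB
  obtain ⟨Bs, hBs⟩ : ∃ Bs : ℝ, Bs = ∑ i ∈ Finset.range (n + 1), B i := ⟨_, rfl⟩
  have hBs0 : 0 ≤ Bs := by rw [hBs]; exact Finset.sum_nonneg fun i _ => hB0 i
  have hBi : ∀ i, i ≤ n → B i ≤ Bs := fun i hi => by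
    rw [hBs]
    exact Finset.single_le_sum (fun j _ => hB0 j) (Finset.mem_range.2 (Nat.lt_succ_of_le hi))
  -- the Schwartz constant (kept opaque)
  obtain ⟨m, hm⟩ : ∃ m : ℕ, m = k + n := ⟨_, rfl⟩
  obtain ⟨S, hS0, hS⟩ : ∃ S : ℝ, 0 ≤ S ∧ ∀ i, i ≤ n → ∀ w : Fin 1 → mixedSpace K,
      (1 + ‖w‖) ^ m * ‖iteratedFDeriv ℝ i Φ w‖ ≤ S := by
    refine ⟨2 ^ m * (Finset.Iic (m, n)).sup (fun p => SchwartzMap.seminorm ℝ p.1 p.2) Φ,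
      mul_nonneg (pow_nonneg zero_le_two _) (apply_nonneg _ _), fun i hi w => ?_⟩
    exact SchwartzMap.one_add_le_sup_seminorm_apply (𝕜 := ℝ) (m := (m, n)) le_rfl hi Φ w
  obtain ⟨C, hC⟩ : ∃ C : ℝ, C = n.factorial * (S * Real.exp 1 ^ m) * (1 + Bs) ^ n := ⟨_, rfl⟩
  refine ⟨C, by rw [hC]; positivity, fun z X hX => ?_⟩
  -- the inner map `Y ↦ z · E Y` as `mul z ∘ E`
  obtain ⟨Mz, hMz⟩ : ∃ Mz : (Fin 1 → mixedSpace K) →L[ℝ] (Fin 1 → mixedSpace K),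
      Mz = ContinuousLinearMap.mul ℝ (Fin 1 → mixedSpace K) z := ⟨_, rfl⟩
  have hMza : ∀ v, Mz v = z * v := fun v => by rw [hMz, ContinuousLinearMap.mul_apply']
  have hcomp : (fun Y : mixedSpace K =>
      Φ (z * fun _ : Fin 1 => ((mixedExpUnit K Y : (mixedSpace K)ˣ) : mixedSpace K))) =
      Φ ∘ (Mz ∘ E) := by
    funext Y
    simp only [Function.comp_apply, hMza, hE]
  have hMzE : ContDiff ℝ ∞ (Mz ∘ E) := Mz.contDiff.comp hEs
  have hMzn : ‖Mz‖ ≤ ‖z‖ := by rw [hMz]; exact ContinuousLinearMap.opNorm_mul_apply_le ℝ _ z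
  -- lower bound for `w = z · E X`
  obtain ⟨w, hw⟩ : ∃ w : Fin 1 → mixedSpace K, w = z * E X := ⟨_, rfl⟩
  have hzw : ‖z‖ ≤ ‖w‖ * Real.exp 1 := by
    rw [hw, hE]
    exact (norm_le_norm_mul_exp_mul K z X).trans (mul_le_mul_of_nonneg_left (Real.exp_le_exp.2 hX)
      (norm_nonneg _))
  have he1 : 1 ≤ Real.exp 1 := Real.one_le_exp zero_le_one
  have h1z : 1 + ‖z‖ ≤ Real.exp 1 * (1 + ‖w‖) := by
    have hw0 : 0 ≤ ‖w‖ := norm_nonneg w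
    calc 1 + ‖z‖ ≤ 1 + ‖w‖ * Real.exp 1 := by linarith
      _ ≤ Real.exp 1 + ‖w‖ * Real.exp 1 := by linarith
      _ = Real.exp 1 * (1 + ‖w‖) := by ring
  have h1z0 : 0 < 1 + ‖z‖ := add_pos_of_pos_of_nonneg one_pos (norm_nonneg z)
  have h1w0 : 0 < 1 + ‖w‖ := add_pos_of_pos_of_nonneg one_pos (norm_nonneg w)
  -- bound on the derivatives of `Φ` at `w`
  have hCΦ : ∀ i, i ≤ n → ‖iteratedFDeriv ℝ i Φ ((Mz ∘ E) X)‖ ≤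
      S * Real.exp 1 ^ m * (1 + ‖z‖) ^ (-(m : ℝ)) := by
    intro i hi
    have hwX : (Mz ∘ E) X = w := by rw [Function.comp_apply, hMza, hw]
    rw [hwX]
    have hsch := hS i hi w
    -- `(1 + ‖w‖)^m ‖∂ⁱΦ(w)‖ ≤ S`
    have hpow : (1 + ‖z‖) ^ (m : ℝ) ≤ Real.exp 1 ^ m * (1 + ‖w‖) ^ m := by
      rw [Real.rpow_natCast, ← mul_pow]
      exact pow_le_pow_left₀ h1z0.le h1z m
    rw [Real.rpow_neg h1z0.le, le_mul_inv_iff₀ (Real.rpow_pos_of_pos h1z0 _)]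
    calc ‖iteratedFDeriv ℝ i Φ w‖ * (1 + ‖z‖) ^ (m : ℝ)
        ≤ ‖iteratedFDeriv ℝ i Φ w‖ * (Real.exp 1 ^ m * (1 + ‖w‖) ^ m) :=
          mul_le_mul_of_nonneg_left hpow (norm_nonneg _)
      _ = Real.exp 1 ^ m * ((1 + ‖w‖) ^ m * ‖iteratedFDeriv ℝ i Φ w‖) := by ring
      _ ≤ Real.exp 1 ^ m * S := mul_le_mul_of_nonneg_left hsch (by positivity)
      _ = S * Real.exp 1 ^ m := mul_comm _ _
  -- bound on the derivatives of `Mz ∘ E`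
  obtain ⟨D, hD⟩ : ∃ D : ℝ, D = max 1 (‖z‖ * Bs) := ⟨_, rfl⟩
  have hD1 : 1 ≤ D := by rw [hD]; exact le_max_left _ _
  have hDE : ∀ i, 1 ≤ i → i ≤ n → ‖iteratedFDeriv ℝ i (Mz ∘ E) X‖ ≤ D ^ i := by
    intro i hi1 hin
    rw [Mz.iteratedFDeriv_comp_left hEs.contDiffAt (by exact_mod_cast le_top)]
    calc ‖Mz.compContinuousMultilinearMap (iteratedFDeriv ℝ i E X)‖
        ≤ ‖Mz‖ * ‖iteratedFDeriv ℝ i E X‖ := ContinuousLinearMap.norm_compContinuousMultilinearMap_le _ _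
      _ ≤ ‖z‖ * Bs := mul_le_mul hMzn ((hB i X hX).trans (hBi i hin)) (norm_nonneg _) (norm_nonneg _)
      _ ≤ D := by rw [hD]; exact le_max_right _ _
      _ ≤ D ^ i := le_self_pow₀ hD1 (Nat.one_le_iff_ne_zero.1 hi1)
  have hDle : D ≤ (1 + Bs) * (1 + ‖z‖) := by
    rw [hD]
    refine max_le ?_ ?_ <;> nlinarith [norm_nonneg z, hBs0]
  -- Faà di Bruno
  have hmain := norm_iteratedFDeriv_comp_le (Φ.smooth ⊤) hMzE (by exact_mod_cast le_top) X hCΦ hDE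
  rw [hcomp]
  refine hmain.trans ?_
  have hDn : D ^ n ≤ (1 + Bs) ^ n * (1 + ‖z‖) ^ n := by
    rw [← mul_pow]
    exact pow_le_pow_left₀ (zero_le_one.trans hD1) hDle n
  have hsplit : (1 + ‖z‖) ^ (-(m : ℝ)) * (1 + ‖z‖) ^ n = (1 + ‖z‖) ^ (-(k : ℝ)) := by
    rw [← Real.rpow_natCast, ← Real.rpow_add h1z0, hm]
    push_cast
    ring_nf
  calc (n.factorial : ℝ) * (S * Real.exp 1 ^ m * (1 + ‖z‖) ^ (-(m : ℝ))) * D ^ n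
      ≤ (n.factorial : ℝ) * (S * Real.exp 1 ^ m * (1 + ‖z‖) ^ (-(m : ℝ))) *
          ((1 + Bs) ^ n * (1 + ‖z‖) ^ n) :=
        mul_le_mul_of_nonneg_left hDn (by positivity)
    _ = C * ((1 + ‖z‖) ^ (-(m : ℝ)) * (1 + ‖z‖) ^ n) := by rw [hC]; ring
    _ = C * (1 + ‖z‖) ^ (-(k : ℝ)) := by rw [hsplit]

end OrbDeriv

/-! ### From extended-real bounds to real sums -/

section ENNRealAux

/-- A family of non-negative reals whose `ofReal`-sum is bounded by a finite extended real is
summable, with sum at most the real part of the bound. [folklore] -/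
theorem summable_and_tsum_le_of_tsum_ofReal_le {ι : Type*} {g : ι → ℝ} (hg : ∀ i, 0 ≤ g i)
    {B : ℝ≥0∞} (hB : B ≠ ⊤) (h : ∑' i, ENNReal.ofReal (g i) ≤ B) :
    Summable g ∧ ∑' i, g i ≤ B.toReal := by
  have hne : ∑' i, ENNReal.ofReal (g i) ≠ ⊤ := ne_top_of_le_ne_top hB h
  have hs : Summable g := by
    have h1 := ENNReal.summable_toReal hne
    simpa only [ENNReal.toReal_ofReal (hg _)] using h1
  refine ⟨hs, ?_⟩
  calc ∑' i, g i = ∑' i, (ENNReal.ofReal (g i)).toReal := tsum_congr fun i => by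
        rw [ENNReal.toReal_ofReal (hg i)]
    _ = (∑' i, ENNReal.ofReal (g i)).toReal := (ENNReal.tsum_toReal_eq fun _ => ENNReal.ofReal_ne_top).symm
    _ ≤ B.toReal := ENNReal.toReal_mono hB h

end ENNRealAux

/-! ### The uniform theta bound: `∑_{a ∈ Kˣ} |Φ_f((a y)_f)| (1 + ‖(a y)_∞‖)^{-k} ≪ |y|^{-θ/[K:ℚ]}` -/

section Theta

variable {K}

/-- The `Kˣ`-sums over `a ↦ a y` do not change under `y ↦ k y`, `k ∈ Kˣ` (reindexing).
[folklore] -/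
theorem tsum_units_comp_principalIdele_mul {β : Type*} [AddCommMonoid β] [TopologicalSpace β]
    (g : AdeleRing (𝓞 K) K → β) (k : Kˣ) (y : GaloisRepresentations.ideleGroup K) :
    ∑' a : Kˣ, g (algebraMap K (AdeleRing (𝓞 K) K) (a : K) *
        ((principalIdele K k * y : GaloisRepresentations.ideleGroup K) :
          AdeleRing (𝓞 K) K)) =
      ∑' a : Kˣ, g (algebraMap K (AdeleRing (𝓞 K) K) (a : K) * (y : AdeleRing (𝓞 K) K)) := by
  have h : ∀ a : Kˣ, algebraMap K (AdeleRing (𝓞 K) K) (a : K) *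
      ((principalIdele K k * y : GaloisRepresentations.ideleGroup K) :
        AdeleRing (𝓞 K) K) =
      algebraMap K (AdeleRing (𝓞 K) K) ((a * k : Kˣ) : K) * (y : AdeleRing (𝓞 K) K) := by
    intro a
    rw [Units.val_mul, Units.val_mul, map_mul, mul_assoc]
    rfl
  simp_rw [h]
  exact (Equiv.mulRight k).tsum_eq fun a : Kˣ =>
    g (algebraMap K (AdeleRing (𝓞 K) K) (a : K) * (y : AdeleRing (𝓞 K) K))

omit [NumberField K] in
/-- The non-zero rational vectors of length one are the units: `Kˣ ≃ {v : K^{Fin 1} | v ≠ 0}`.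
[folklore] -/
theorem exists_equiv_units_ne_zero_vec :
    ∃ eqv : Kˣ ≃ ↥{v : Fin 1 → K | v ≠ 0}, ∀ a : Kˣ, ((eqv a : ↥{v : Fin 1 → K | v ≠ 0}) : Fin 1 → K) =
      fun _ => (a : K) := by
  have hne : ∀ v : Fin 1 → K, v ≠ 0 ↔ v 0 ≠ 0 := fun v => by
    constructor
    · intro hv h0
      exact hv (funext fun i => by rw [Subsingleton.elim i 0, h0]; rfl)
    · intro h0 hv
      exact h0 (by rw [hv]; rfl)
  refine ⟨{ toFun := fun a => ⟨fun _ => (a : K), (hne _).2 a.ne_zero⟩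
            invFun := fun v => Units.mk0 (v.1 0) ((hne v.1).1 v.2)
            left_inv := fun a => Units.ext rfl
            right_inv := fun v => Subtype.ext (funext fun i => by
              rw [Subsingleton.elim i 0]; rfl) }, fun a => rfl⟩

/-- **The uniform theta bound.** For a locally constant compactly supported `Φ_f` on
`(𝔸_K^∞)^{Fin 1}`, `k ∈ ℕ` and `[K:ℚ] < θ ≤ k` there is `A ≥ 0` such that for every idele `y`
the sum `∑_{a ∈ Kˣ} |Φ_f((a y)_f)| (1 + ‖(a y)_∞‖)^{-k}` converges and is at most
`A · |y|^{-θ/[K:ℚ]}`: on the dyadic sets of representatives this is the theta estimate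
`exists_tsum_enorm_smul_le_of_decay` with the lattice sums `tsum_norm_vecInfinitePart_rpow_neg_lt_top`,
and the sum is invariant under `y ↦ k y`, `k ∈ Kˣ` (Godement–Jacquet, LNM 260, §11, for the
estimate; Meyer (2005), Lemma 5.3 for the use). [cite: Meyer2005, Lemma 5.3] -/
theorem exists_tsum_decay_le_rpow_ideleNorm {Φfin : (Fin 1 → FiniteAdeleRing (𝓞 K) K) → ℂ}
    (hfin : Φfin ∈ SchwartzBruhat (Fin 1 → FiniteAdeleRing (𝓞 K) K)) (k : ℕ) {θ : ℝ}
    (hθd : (Module.finrank ℚ K : ℝ) < θ) (hθk : θ ≤ k) :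
    ∃ A : ℝ, 0 ≤ A ∧ ∀ y : GaloisRepresentations.ideleGroup K,
      Summable (fun a : Kˣ => ‖Φfin (fun _ => (algebraMap K (AdeleRing (𝓞 K) K) (a : K) *
          (y : AdeleRing (𝓞 K) K)).2)‖ *
        (1 + ‖(fun _ : Fin 1 => InfiniteAdeleRing.ringEquiv_mixedSpace K
          (algebraMap K (AdeleRing (𝓞 K) K) (a : K) * (y : AdeleRing (𝓞 K) K)).1)‖) ^ (-(k : ℝ))) ∧
      ∑' a : Kˣ, ‖Φfin (fun _ => (algebraMap K (AdeleRing (𝓞 K) K) (a : K) *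
          (y : AdeleRing (𝓞 K) K)).2)‖ *
        (1 + ‖(fun _ : Fin 1 => InfiniteAdeleRing.ringEquiv_mixedSpace K
          (algebraMap K (AdeleRing (𝓞 K) K) (a : K) * (y : AdeleRing (𝓞 K) K)).1)‖) ^ (-(k : ℝ)) ≤
        A * (IdeleClassGroup.ideleNorm K y : ℝ) ^ (-θ / Module.finrank ℚ K) := by
  obtain ⟨hlc, hcs⟩ := (mem_schwartzBruhat_iff).1 hfin
  -- a bound for `Φ_f`
  obtain ⟨M₀, hM₀⟩ := hlc.continuous.bounded_above_of_compact_support hcs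
  obtain ⟨M, hM⟩ : ∃ M : ℝ, M = max M₀ 0 := ⟨_, rfl⟩
  have hM0 : 0 ≤ M := by rw [hM]; exact le_max_right _ _
  have hMb : ∀ x, ‖Φfin x‖ ≤ M := fun x => (hM₀ x).trans (by rw [hM]; exact le_max_left _ _)
  -- the real-valued majorant `G` on `𝔸_K^{Fin 1}`
  obtain ⟨g, hg⟩ : ∃ g : (Fin 1 → AdeleRing (𝓞 K) K) → ℝ, g = fun w =>
    ‖Φfin (vecFinitePart K 1 w)‖ * (1 + ‖vecInfinitePart K 1 w‖) ^ (-(k : ℝ)) := ⟨_, rfl⟩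
  have hg0 : ∀ w, 0 ≤ g w := fun w => by
    rw [hg]
    exact mul_nonneg (norm_nonneg _) (Real.rpow_nonneg (by positivity) _)
  obtain ⟨G, hG⟩ : ∃ G : (Fin 1 → AdeleRing (𝓞 K) K) → ℂ, G = fun w => (g w : ℂ) := ⟨_, rfl⟩
  have hGnorm : ∀ w, ‖G w‖ = g w := fun w => by
    rw [hG, Complex.norm_real, Real.norm_of_nonneg (hg0 w)]
  have hGdecay : ∀ w, ‖G w‖ ≤ M * (1 + ‖vecInfinitePart K 1 w‖) ^ (-(k : ℝ)) := fun w => by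
    rw [hGnorm, hg]
    exact mul_le_mul_of_nonneg_right (hMb _) (Real.rpow_nonneg (by positivity) _)
  have hGsupp : ∀ w, vecFinitePart K 1 w ∉ tsupport Φfin → G w = 0 := fun w hw => by
    rw [hG]
    change ((g w : ℝ) : ℂ) = 0
    rw [hg]
    simp only [image_eq_zero_of_notMem_tsupport hw, norm_zero, zero_mul, Complex.ofReal_zero]
  -- the theta estimate on the dyadic sets of representatives
  obtain ⟨c, C, hc, hCc, hbound⟩ := exists_tsum_enorm_smul_le_of_decay K
    (1 : GL (Fin 1) (AdeleRing (𝓞 K) K)) hM0 hGdecay hcs hGsupp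
  obtain ⟨Z, hZ⟩ : ∃ Z : ℝ≥0∞, Z = ∑' v : ↥{v : Fin 1 → K | v ≠ 0 ∧
      vecFinitePart K 1 (ratVec K v ᵥ* ((1 : GL (Fin 1) (AdeleRing (𝓞 K) K)) :
        Matrix (Fin 1) (Fin 1) (AdeleRing (𝓞 K) K))) ∈ C},
    ENNReal.ofReal (‖vecInfinitePart K 1 (ratVec K (v : Fin 1 → K) ᵥ*
      ((1 : GL (Fin 1) (AdeleRing (𝓞 K) K)) : Matrix (Fin 1) (Fin 1) (AdeleRing (𝓞 K) K)))‖ ^ (-θ)) :=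
    ⟨_, rfl⟩
  have hZtop : Z < ⊤ := by
    rw [hZ]
    exact tsum_norm_vecInfinitePart_rpow_neg_lt_top K 1 hCc (by simpa using hθd)
  have hθ0 : 0 ≤ θ := le_trans (by positivity) hθd.le
  obtain ⟨d, hd⟩ : ∃ d : ℕ, d = Module.finrank ℚ K := ⟨_, rfl⟩
  have hdpos : (0 : ℝ) < d := by rw [hd]; exact Nat.cast_pos.2 Module.finrank_pos
  rw [← hd]
  refine ⟨M * c ^ (-θ) * Z.toReal * 2, by positivity, fun y₀ => ?_⟩
  -- reduce to a dyadic representative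
  obtain ⟨N, hN⟩ : ∃ N : ℝ, N = (IdeleClassGroup.ideleNorm K y₀ : ℝ) := ⟨_, rfl⟩
  have hN0 : 0 < N := by rw [hN]; exact NNReal.coe_pos.2 (pos_iff_ne_zero.2 (ideleNorm_ne_zero y₀))
  rw [← hN]
  obtain ⟨r₀, hr₀⟩ : ∃ r₀ : ℝ, r₀ = N ^ (1 / (d : ℝ)) := ⟨_, rfl⟩
  have hr₀pos : 0 < r₀ := by rw [hr₀]; exact Real.rpow_pos_of_pos hN0 _
  have hr₀d : r₀ ^ d = N := by
    rw [hr₀, ← Real.rpow_natCast, ← Real.rpow_mul hN0.le, one_div_mul_cancel hdpos.ne', Real.rpow_one]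
  have hr₀ne : (⟨r₀, hr₀pos.le⟩ : ℝ≥0) ≠ 0 := fun h => hr₀pos.ne' (congrArg (fun t : ℝ≥0 => (t : ℝ)) h)
  obtain ⟨r, hr⟩ : ∃ r : ℝ≥0ˣ, r = Units.mk0 ⟨r₀, hr₀pos.le⟩ hr₀ne := ⟨_, rfl⟩
  have hrcoe : ((r : ℝ≥0) : ℝ) = r₀ := by rw [hr]; rfl
  have hrd : ((r : ℝ≥0) : ℝ) ^ Module.finrank ℚ K = N := by rw [hrcoe, ← hd, hr₀d]
  obtain ⟨k₁, y, hy, hy₀⟩ := exists_principalIdele_mul_mem_dyadicIdeleSet K r (x := y₀)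
    (by rw [hrd, hN]; linarith [hN0]) (by rw [hrd, hN]; linarith [hN0])
  -- the sum at `y₀` equals the sum at `y`
  have hreindex : ∀ F : AdeleRing (𝓞 K) K → ℝ,
      ∑' a : Kˣ, F (algebraMap K (AdeleRing (𝓞 K) K) (a : K) * (y₀ : AdeleRing (𝓞 K) K)) =
        ∑' a : Kˣ, F (algebraMap K (AdeleRing (𝓞 K) K) (a : K) * (y : AdeleRing (𝓞 K) K)) := by
    intro F
    rw [hy₀]
    exact tsum_units_comp_principalIdele_mul F k₁ y
  -- the ENNReal bound at `y`
  have hb := hbound θ hθ0 hθk r y hy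
  rw [← hZ] at hb
  obtain ⟨eqv, heqv⟩ := exists_equiv_units_ne_zero_vec (K := K)
  have hterm : ∀ a : Kˣ,
      (‖G ((((y : (AdeleRing (𝓞 K) K)ˣ) : AdeleRing (𝓞 K) K)) •
        (ratVec K ((eqv a : ↥{v : Fin 1 → K | v ≠ 0}) : Fin 1 → K) ᵥ*
          ((1 : GL (Fin 1) (AdeleRing (𝓞 K) K)) : Matrix (Fin 1) (Fin 1) (AdeleRing (𝓞 K) K))))‖ₑ : ℝ≥0∞) =
      ENNReal.ofReal (g (fun _ => algebraMap K (AdeleRing (𝓞 K) K) (a : K) * (y : AdeleRing (𝓞 K) K))) := by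
    intro a
    rw [← ofReal_norm, hGnorm, heqv a, Units.val_one, Matrix.vecMul_one]
    congr 2
    funext i
    rw [Pi.smul_apply, smul_eq_mul, mul_comm]
    rfl
  have hsumeq : ∑' v : ↥{v : Fin 1 → K | v ≠ 0},
      (‖G ((((y : (AdeleRing (𝓞 K) K)ˣ) : AdeleRing (𝓞 K) K)) •
        (ratVec K (v : Fin 1 → K) ᵥ*
          ((1 : GL (Fin 1) (AdeleRing (𝓞 K) K)) : Matrix (Fin 1) (Fin 1) (AdeleRing (𝓞 K) K))))‖ₑ : ℝ≥0∞) =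
      ∑' a : Kˣ, ENNReal.ofReal (g (fun _ => algebraMap K (AdeleRing (𝓞 K) K) (a : K) * (y : AdeleRing (𝓞 K) K))) := by
    rw [← eqv.tsum_eq]
    exact tsum_congr hterm
  rw [hsumeq] at hb
  -- pass to reals
  have hBtop : ENNReal.ofReal (M * (c * ((r : ℝ≥0) : ℝ)) ^ (-θ)) * Z ≠ ⊤ :=
    ENNReal.mul_ne_top ENNReal.ofReal_ne_top hZtop.ne
  obtain ⟨hsum, hle⟩ := summable_and_tsum_le_of_tsum_ofReal_le (fun a => hg0 _) hBtop hb
  -- identify the summand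
  have hgid : (fun a : Kˣ => g (fun _ => algebraMap K (AdeleRing (𝓞 K) K) (a : K) * (y : AdeleRing (𝓞 K) K))) =
      fun a : Kˣ => ‖Φfin (fun _ => (algebraMap K (AdeleRing (𝓞 K) K) (a : K) * (y : AdeleRing (𝓞 K) K)).2)‖ *
        (1 + ‖(fun _ : Fin 1 => InfiniteAdeleRing.ringEquiv_mixedSpace K
          (algebraMap K (AdeleRing (𝓞 K) K) (a : K) * (y : AdeleRing (𝓞 K) K)).1)‖) ^ (-(k : ℝ)) := by
    rw [hg]
    rfl
  rw [hgid] at hsum hle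
  -- transport back to `y₀`
  have hsum₀ := hsum
  constructor
  · -- summability at `y₀` by reindexing
    have heq : (fun a : Kˣ => ‖Φfin (fun _ => (algebraMap K (AdeleRing (𝓞 K) K) (a : K) *
          (y₀ : AdeleRing (𝓞 K) K)).2)‖ *
        (1 + ‖(fun _ : Fin 1 => InfiniteAdeleRing.ringEquiv_mixedSpace K
          (algebraMap K (AdeleRing (𝓞 K) K) (a : K) * (y₀ : AdeleRing (𝓞 K) K)).1)‖) ^ (-(k : ℝ))) =
        fun a : Kˣ => (fun a' : Kˣ => ‖Φfin (fun _ => (algebraMap K (AdeleRing (𝓞 K) K) (a' : K) *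
          (y : AdeleRing (𝓞 K) K)).2)‖ *
        (1 + ‖(fun _ : Fin 1 => InfiniteAdeleRing.ringEquiv_mixedSpace K
          (algebraMap K (AdeleRing (𝓞 K) K) (a' : K) * (y : AdeleRing (𝓞 K) K)).1)‖) ^ (-(k : ℝ)))
          (Equiv.mulRight k₁ a) := by
      funext a
      simp only [Equiv.coe_mulRight]
      rw [hy₀, Units.val_mul, Units.val_mul, map_mul, mul_assoc]
      rfl
    rw [heq]
    exact hsum₀.comp_injective (Equiv.mulRight k₁).injective
  · rw [hreindex (fun z => ‖Φfin (fun _ => z.2)‖ *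
        (1 + ‖(fun _ : Fin 1 => InfiniteAdeleRing.ringEquiv_mixedSpace K z.1)‖) ^ (-(k : ℝ)))]
    refine hle.trans ?_
    -- evaluate the constant
    have hr0' : 0 < ((r : ℝ≥0) : ℝ) := by rw [hrcoe]; exact hr₀pos
    rw [ENNReal.toReal_mul, ENNReal.toReal_ofReal (by positivity), Real.mul_rpow hc.le hr0'.le,
      hrcoe, hr₀, ← Real.rpow_mul hN0.le]
    have hexp : 1 / (d : ℝ) * -θ = -θ / d := by ring
    rw [hexp]
    have hNpow : 0 ≤ N ^ (-θ / d) := Real.rpow_nonneg hN0.le _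
    have hZr : 0 ≤ Z.toReal := ENNReal.toReal_nonneg
    have hcθ : 0 ≤ c ^ (-θ) := Real.rpow_nonneg hc.le _
    have hprod : 0 ≤ M * c ^ (-θ) * Z.toReal * N ^ (-θ / d) := by positivity
    calc M * (c ^ (-θ) * N ^ (-θ / ↑d)) * Z.toReal = M * c ^ (-θ) * Z.toReal * N ^ (-θ / d) := by ring
      _ ≤ M * c ^ (-θ) * Z.toReal * N ^ (-θ / d) * 2 := by nlinarith
      _ = M * c ^ (-θ) * Z.toReal * 2 * N ^ (-θ / ↑d) := by ring

end Theta

/-! ### Invariance under an open subgroup of the finite idele units -/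

section OpenSubgroup

variable {K}

/-- **A Schwartz–Bruhat function on `(𝔸_K^∞)^{Fin 1}` is invariant under an open subgroup of
`(𝔸_K^∞)ˣ`**: for `Φ` locally constant with compact support there is an open subgroup `U` with
`Φ(x u) = Φ(x)` for all `x` and `u ∈ U` (the difference `Φ(x u) - Φ(x)` is a locally constant
function of `(x, u)` vanishing at `u = 1`; compactness of the support gives a uniform
neighbourhood of `1`, and the stabiliser subgroup containing it is open). [folklore] -/
theorem exists_openSubgroup_forall_comp_mul_eq {Φ : (Fin 1 → FiniteAdeleRing (𝓞 K) K) → ℂ}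
    (hΦ : Φ ∈ SchwartzBruhat (Fin 1 → FiniteAdeleRing (𝓞 K) K)) :
    ∃ U : OpenSubgroup (FiniteAdeleRing (𝓞 K) K)ˣ, ∀ u ∈ U, ∀ x : Fin 1 → FiniteAdeleRing (𝓞 K) K,
      Φ (fun i => x i * (u : FiniteAdeleRing (𝓞 K) K)) = Φ x := by
  obtain ⟨hlc, hcs⟩ := (mem_schwartzBruhat_iff).1 hΦ
  -- the locally constant difference `h (x, u) = Φ (x u) - Φ x`
  set m : (Fin 1 → FiniteAdeleRing (𝓞 K) K) × (FiniteAdeleRing (𝓞 K) K)ˣ →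
      (Fin 1 → FiniteAdeleRing (𝓞 K) K) := fun p i => p.1 i * (p.2 : FiniteAdeleRing (𝓞 K) K) with hm
  have hmc : Continuous m := continuous_pi fun i =>
    ((continuous_apply i).comp continuous_fst).mul (Units.continuous_val.comp continuous_snd)
  set h : (Fin 1 → FiniteAdeleRing (𝓞 K) K) × (FiniteAdeleRing (𝓞 K) K)ˣ → ℂ :=
    fun p => Φ (m p) - Φ p.1 with hh
  have hhl : IsLocallyConstant h :=
    (hlc.comp_continuous hmc).comp₂ (hlc.comp_continuous continuous_fst) (· - ·)
  have hZo : IsOpen (h ⁻¹' {0}) := hhl.isOpen_fiber 0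
  have h1 : ∀ x, (x, (1 : (FiniteAdeleRing (𝓞 K) K)ˣ)) ∈ h ⁻¹' {0} := fun x => by
    simp only [Set.mem_preimage, Set.mem_singleton_iff, hh, hm, Units.val_one, mul_one]
    exact sub_self _
  have hbox : ∀ x, ∃ A : Set (Fin 1 → FiniteAdeleRing (𝓞 K) K), ∃ B : Set (FiniteAdeleRing (𝓞 K) K)ˣ,
      IsOpen A ∧ IsOpen B ∧ x ∈ A ∧ (1 : (FiniteAdeleRing (𝓞 K) K)ˣ) ∈ B ∧ A ×ˢ B ⊆ h ⁻¹' {0} :=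
    fun x => isOpen_prod_iff.1 hZo x 1 (h1 x)
  choose A B hAo hBo hxA h1B hAB using hbox
  -- a finite subcover of the support
  obtain ⟨T, hT⟩ := hcs.elim_finite_subcover A hAo fun x _ => Set.mem_iUnion.2 ⟨x, hxA x⟩
  set V : Set (FiniteAdeleRing (𝓞 K) K)ˣ := ⋂ x ∈ T, B x with hV
  have hVo : IsOpen V := isOpen_biInter_finset fun x _ => hBo x
  have h1V : (1 : (FiniteAdeleRing (𝓞 K) K)ˣ) ∈ V := Set.mem_iInter₂.2 fun x _ => h1B x
  -- invariance on the support for `u ∈ V`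
  have hsupp : ∀ u ∈ V, ∀ x ∈ tsupport Φ,
      Φ (fun i => x i * (u : FiniteAdeleRing (𝓞 K) K)) = Φ x := by
    intro u hu x hx
    obtain ⟨x₀, hx₀T, hxx₀⟩ := Set.mem_iUnion₂.1 (hT hx)
    have huB : u ∈ B x₀ := Set.mem_iInter₂.1 hu x₀ hx₀T
    have hmem : (x, u) ∈ h ⁻¹' {0} := hAB x₀ (Set.mk_mem_prod hxx₀ huB)
    simp only [Set.mem_preimage, Set.mem_singleton_iff, hh, hm] at hmem
    exact sub_eq_zero.1 hmem
  -- invariance everywhere for `u ∈ V ∩ V⁻¹`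
  have hall : ∀ u ∈ V, u⁻¹ ∈ V → ∀ x, Φ (fun i => x i * (u : FiniteAdeleRing (𝓞 K) K)) = Φ x := by
    intro u hu hu' x
    by_cases hx : x ∈ tsupport Φ
    · exact hsupp u hu x hx
    by_cases hxu : (fun i => x i * (u : FiniteAdeleRing (𝓞 K) K)) ∈ tsupport Φ
    · have h2 := hsupp u⁻¹ hu' _ hxu
      have h3 : (fun i => (fun i => x i * (u : FiniteAdeleRing (𝓞 K) K)) i *
          ((u⁻¹ : (FiniteAdeleRing (𝓞 K) K)ˣ) : FiniteAdeleRing (𝓞 K) K)) = x := by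
        funext i
        simp only [mul_assoc, Units.mul_inv, mul_one]
      rw [h3] at h2
      exact h2.symm
    rw [image_eq_zero_of_notMem_tsupport hx, image_eq_zero_of_notMem_tsupport hxu]
  -- the stabiliser subgroup
  let U₀ : Subgroup (FiniteAdeleRing (𝓞 K) K)ˣ :=
    { carrier := {u | ∀ x : Fin 1 → FiniteAdeleRing (𝓞 K) K,
        Φ (fun i => x i * (u : FiniteAdeleRing (𝓞 K) K)) = Φ x}
      mul_mem' := fun {u v} hu hv x => by
        have h2 := hv (fun i => x i * (u : FiniteAdeleRing (𝓞 K) K))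
        simp only [mul_assoc] at h2
        rw [Units.val_mul, h2, hu x]
      one_mem' := fun x => by simp only [Units.val_one, mul_one]
      inv_mem' := fun {u} hu x => by
        have h2 := hu (fun i => x i * ((u⁻¹ : (FiniteAdeleRing (𝓞 K) K)ˣ) : FiniteAdeleRing (𝓞 K) K))
        simp only [mul_assoc, Units.inv_mul, mul_one] at h2
        exact h2.symm }
  have hU₀ : (U₀ : Set (FiniteAdeleRing (𝓞 K) K)ˣ) ∈ 𝓝 (1 : (FiniteAdeleRing (𝓞 K) K)ˣ) := by
    have hW : V ∩ (fun u => u⁻¹) ⁻¹' V ∈ 𝓝 (1 : (FiniteAdeleRing (𝓞 K) K)ˣ) :=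
      Filter.inter_mem (hVo.mem_nhds h1V) ((hVo.preimage continuous_inv).mem_nhds (by
        rw [Set.mem_preimage, inv_one]; exact h1V))
    exact Filter.mem_of_superset hW fun u hu => hall u hu.1 hu.2
  exact ⟨⟨U₀, U₀.isOpen_of_mem_nhds hU₀⟩, fun u hu x => hu x⟩

/-- **`𝒪̂ˣ` is open** in the finite idele group (both `u` and `u⁻¹` integral are open conditions
on the integral adeles `𝒪̂`, which are open). [folklore] -/
theorem isOpen_integralFiniteUnits :
    IsOpen (integralFiniteUnits K : Set (FiniteAdeleRing (𝓞 K) K)ˣ) := by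
  have hset : (integralFiniteUnits K : Set (FiniteAdeleRing (𝓞 K) K)ˣ) =
      (fun u : (FiniteAdeleRing (𝓞 K) K)ˣ => (u : FiniteAdeleRing (𝓞 K) K)) ⁻¹'
          (integralFiniteAdeles K : Set (FiniteAdeleRing (𝓞 K) K)) ∩
        (fun u : (FiniteAdeleRing (𝓞 K) K)ˣ => ((u⁻¹ : (FiniteAdeleRing (𝓞 K) K)ˣ) :
          FiniteAdeleRing (𝓞 K) K)) ⁻¹' (integralFiniteAdeles K : Set (FiniteAdeleRing (𝓞 K) K)) := by
    ext u
    simp only [SetLike.mem_coe, Set.mem_inter_iff, Set.mem_preimage, mem_integralFiniteAdeles_iff]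
    exact ⟨fun hu => ⟨fun v => (hu v).1, fun v => (hu v).2⟩, fun hu v => ⟨hu.1 v, hu.2 v⟩⟩
  rw [hset]
  exact ((isOpen_integralFiniteAdeles K).preimage Units.continuous_val).inter
    ((isOpen_integralFiniteAdeles K).preimage Units.continuous_coe_inv)

end OpenSubgroup

/-! ### The orbit maps of `Σ f` for a pure tensor `f = Φ_∞ ⊗ Φ_f` -/

section Tensor

variable {K}

/-- The archimedean one-parameter class is the class of the idele `(exp X, 1)`. [folklore] -/
theorem archExpClass_eq_mk (X : mixedSpace K) :
    archExpClass K X = IdeleClassGroup.mk K (GaloisRepresentations.infiniteIdeles K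
      (Units.map ((InfiniteAdeleRing.ringEquiv_mixedSpace K).symm :
        mixedSpace K ≃+* InfiniteAdeleRing K).toMonoidHom (mixedExpUnit K X))) := rfl

/-- The archimedean component of `z · (exp X, 1)`, read in the mixed space, is `z_∞ · exp X`.
[folklore] -/
theorem ringEquiv_fst_mul_expIdele (z : AdeleRing (𝓞 K) K) (X : mixedSpace K) :
    InfiniteAdeleRing.ringEquiv_mixedSpace K (z * ((GaloisRepresentations.infiniteIdeles K
      (Units.map ((InfiniteAdeleRing.ringEquiv_mixedSpace K).symm :
        mixedSpace K ≃+* InfiniteAdeleRing K).toMonoidHom (mixedExpUnit K X)) :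
          GaloisRepresentations.ideleGroup K) : AdeleRing (𝓞 K) K)).1 =
      InfiniteAdeleRing.ringEquiv_mixedSpace K z.1 *
        ((mixedExpUnit K X : (mixedSpace K)ˣ) : mixedSpace K) := by
  have hfst : ∀ a b : AdeleRing (𝓞 K) K, (a * b).1 = a.1 * b.1 := fun _ _ => rfl
  rw [hfst, map_mul]
  congr 1
  exact (InfiniteAdeleRing.ringEquiv_mixedSpace K).apply_symm_apply _

/-- The finite component of `z · (exp X, 1)` is that of `z`. [folklore] -/
theorem snd_mul_expIdele (z : AdeleRing (𝓞 K) K) (X : mixedSpace K) :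
    (z * ((GaloisRepresentations.infiniteIdeles K
      (Units.map ((InfiniteAdeleRing.ringEquiv_mixedSpace K).symm :
        mixedSpace K ≃+* InfiniteAdeleRing K).toMonoidHom (mixedExpUnit K X)) :
          GaloisRepresentations.ideleGroup K) : AdeleRing (𝓞 K) K)).2 = z.2 := by
  have hsnd : ∀ a b : AdeleRing (𝓞 K) K, (a * b).2 = a.2 * b.2 := fun _ _ => rfl
  rw [hsnd]
  exact mul_one _

/-- **The orbit map of `Σ f` at the class of an idele `y`** is the series
`X ↦ ∑_{a ∈ Kˣ} f(a · y · (exp X, 1))`. [cite: Meyer2005, §5.3] -/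
theorem archOrbit_meyerSum_mk (f : AdeleRing (𝓞 K) K → ℂ) (y : GaloisRepresentations.ideleGroup K)
    (X : mixedSpace K) :
    archOrbit K (meyerSum K f) (IdeleClassGroup.mk K y) X =
      ∑' a : Kˣ, f (algebraMap K (AdeleRing (𝓞 K) K) (a : K) *
        ((y * GaloisRepresentations.infiniteIdeles K
          (Units.map ((InfiniteAdeleRing.ringEquiv_mixedSpace K).symm :
            mixedSpace K ≃+* InfiniteAdeleRing K).toMonoidHom (mixedExpUnit K X)) :
              GaloisRepresentations.ideleGroup K) : AdeleRing (𝓞 K) K)) := by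
  rw [archOrbit_apply, archExpClass_eq_mk, ← map_mul]
  rfl

/-- The terms of the orbit series for a pure tensor `f = Φ_∞ ⊗ Φ_f`:
`f(a y (exp X, 1)) = Φ_f((a y)_f) · Φ_∞((a y)_∞ exp X)`. [folklore] -/
theorem tensor_apply_mul_expIdele (Φinf : SchwartzMap (Fin 1 → mixedSpace K) ℂ)
    (Φfin : (Fin 1 → FiniteAdeleRing (𝓞 K) K) → ℂ) (z : AdeleRing (𝓞 K) K) (X : mixedSpace K) :
    Φinf (fun _ => InfiniteAdeleRing.ringEquiv_mixedSpace K
        (z * ((GaloisRepresentations.infiniteIdeles K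
          (Units.map ((InfiniteAdeleRing.ringEquiv_mixedSpace K).symm :
            mixedSpace K ≃+* InfiniteAdeleRing K).toMonoidHom (mixedExpUnit K X)) :
              GaloisRepresentations.ideleGroup K) : AdeleRing (𝓞 K) K)).1) *
      Φfin (fun _ => (z * ((GaloisRepresentations.infiniteIdeles K
          (Units.map ((InfiniteAdeleRing.ringEquiv_mixedSpace K).symm :
            mixedSpace K ≃+* InfiniteAdeleRing K).toMonoidHom (mixedExpUnit K X)) :
              GaloisRepresentations.ideleGroup K) : AdeleRing (𝓞 K) K)).2) =
      Φfin (fun _ => z.2) • Φinf ((fun _ : Fin 1 => InfiniteAdeleRing.ringEquiv_mixedSpace K z.1) *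
        fun _ : Fin 1 => ((mixedExpUnit K X : (mixedSpace K)ˣ) : mixedSpace K)) := by
  rw [snd_mul_expIdele, smul_eq_mul, mul_comm]
  congr 1
  congr 1
  funext i
  rw [Pi.mul_apply, ringEquiv_fst_mul_expIdele]

/-- The orbit terms `X ↦ Φ_∞(z exp X)` are smooth. [folklore] -/
theorem contDiff_schwartz_mul_exp (Φ : SchwartzMap (Fin 1 → mixedSpace K) ℂ)
    (z : Fin 1 → mixedSpace K) :
    ContDiff ℝ ∞ fun Y : mixedSpace K =>
      Φ (z * fun _ : Fin 1 => ((mixedExpUnit K Y : (mixedSpace K)ˣ) : mixedSpace K)) :=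
  (Φ.smooth ⊤).comp ((contDiff_const (c := z)).mul (contDiff_const_mixedExpUnit_val K))

/-- **Summability along `Kˣ` of a Schwartz–Bruhat function** at every idele:
`∑_{a ∈ Kˣ} |F(a y)| < ∞` for `F ∈ 𝒮(𝔸_K^{Fin 1})`. [folklore] -/
theorem summable_units_of_mem_piSchwartzBruhat {F : (Fin 1 → AdeleRing (𝓞 K) K) → ℂ}
    (hF : F ∈ piSchwartzBruhat K (Fin 1)) (y : GaloisRepresentations.ideleGroup K) :
    Summable fun a : Kˣ => F (fun _ => algebraMap K (AdeleRing (𝓞 K) K) (a : K) *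
      (y : AdeleRing (𝓞 K) K)) := by
  have h := summable_norm_of_mem_piSchwartzBruhat (comp_smul_mem_piSchwartzBruhat hF y)
  have hinj : Function.Injective fun a : Kˣ => (fun _ : Fin 1 => (a : K)) := by
    intro a b hab
    exact Units.ext (congrFun hab 0)
  refine Summable.of_norm ?_
  have h2 := h.comp_injective hinj
  refine h2.congr fun a => ?_
  simp only [Function.comp_apply]
  congr 2
  funext i
  rw [Pi.smul_apply, smul_eq_mul, mul_comm]

/-- **The orbit map of `Σ(Φ_∞ ⊗ Φ_f)` is smooth at `0`, with term-by-term derivatives** bounded by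
the theta series: for every `n` and `[K:ℚ] < k`, with the constant `C` of
`exists_norm_iteratedFDeriv_schwartz_mul_exp_le`,
`‖∂ⁿ_X Σf(y exp X)|₀‖ ≤ C ∑_{a ∈ Kˣ} |Φ_f((a y)_f)| (1 + ‖(a y)_∞‖)^{-k}`
(localized term-by-term differentiation, `Literature.Analysis.Calculus`). [cite: Meyer2005, Lemma 5.3] -/
theorem contDiffAt_and_norm_iteratedFDeriv_archOrbit_meyerSum_tensor_le
    (Φinf : SchwartzMap (Fin 1 → mixedSpace K) ℂ) {Φfin : (Fin 1 → FiniteAdeleRing (𝓞 K) K) → ℂ}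
    (hfin : Φfin ∈ SchwartzBruhat (Fin 1 → FiniteAdeleRing (𝓞 K) K))
    (y : GaloisRepresentations.ideleGroup K) :
    ContDiffAt ℝ ∞ (archOrbit K (meyerSum K (fun x : AdeleRing (𝓞 K) K =>
      Φinf (fun _ => InfiniteAdeleRing.ringEquiv_mixedSpace K x.1) * Φfin (fun _ => x.2)))
        (IdeleClassGroup.mk K y)) 0 ∧
      ∀ (n k : ℕ), Module.finrank ℚ K < k → ∀ {C : ℝ}, 0 ≤ C →
        (∀ (z : Fin 1 → mixedSpace K) (X : mixedSpace K), ‖X‖ ≤ 1 →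
          ‖iteratedFDeriv ℝ n (fun Y : mixedSpace K =>
            Φinf (z * fun _ : Fin 1 => ((mixedExpUnit K Y : (mixedSpace K)ˣ) : mixedSpace K))) X‖ ≤
              C * (1 + ‖z‖) ^ (-(k : ℝ))) →
        ‖iteratedFDeriv ℝ n (archOrbit K (meyerSum K (fun x : AdeleRing (𝓞 K) K =>
          Φinf (fun _ => InfiniteAdeleRing.ringEquiv_mixedSpace K x.1) * Φfin (fun _ => x.2)))
            (IdeleClassGroup.mk K y)) 0‖ ≤
          C * ∑' a : Kˣ, ‖Φfin (fun _ => (algebraMap K (AdeleRing (𝓞 K) K) (a : K) *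
              (y : AdeleRing (𝓞 K) K)).2)‖ *
            (1 + ‖(fun _ : Fin 1 => InfiniteAdeleRing.ringEquiv_mixedSpace K
              (algebraMap K (AdeleRing (𝓞 K) K) (a : K) * (y : AdeleRing (𝓞 K) K)).1)‖) ^ (-(k : ℝ)) := by
  -- notation: coefficients, archimedean points, orbit terms
  obtain ⟨c, hc⟩ : ∃ c : Kˣ → ℂ, c = fun a : Kˣ => Φfin (fun _ => (algebraMap K (AdeleRing (𝓞 K) K) (a : K) *
      (y : AdeleRing (𝓞 K) K)).2) := ⟨_, rfl⟩
  obtain ⟨z, hz⟩ : ∃ z : Kˣ → (Fin 1 → mixedSpace K), z = fun (a : Kˣ) (_ : Fin 1) =>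
      InfiniteAdeleRing.ringEquiv_mixedSpace K
        (algebraMap K (AdeleRing (𝓞 K) K) (a : K) * (y : AdeleRing (𝓞 K) K)).1 := ⟨_, rfl⟩
  obtain ⟨orb, horb⟩ : ∃ orb : (Fin 1 → mixedSpace K) → mixedSpace K → ℂ, orb = fun w Y =>
      Φinf (w * fun _ : Fin 1 => ((mixedExpUnit K Y : (mixedSpace K)ˣ) : mixedSpace K)) := ⟨_, rfl⟩
  have horbs : ∀ w, ContDiff ℝ ∞ (orb w) := fun w => by rw [horb]; exact contDiff_schwartz_mul_exp Φinf w
  -- the orbit map as a series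
  have hseries : archOrbit K (meyerSum K (fun x : AdeleRing (𝓞 K) K =>
      Φinf (fun _ => InfiniteAdeleRing.ringEquiv_mixedSpace K x.1) * Φfin (fun _ => x.2)))
        (IdeleClassGroup.mk K y) = fun X => ∑' a : Kˣ, c a • orb (z a) X := by
    funext X
    rw [archOrbit_meyerSum_mk]
    refine tsum_congr fun a => ?_
    rw [Units.val_mul, ← mul_assoc, tensor_apply_mul_expIdele, hc, hz, horb]
  -- summable bounds for every order
  have hθ : (Module.finrank ℚ K : ℝ) < (Module.finrank ℚ K + 1 : ℕ) := by push_cast; linarith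
  obtain ⟨A, -, hA⟩ := exists_tsum_decay_le_rpow_ideleNorm hfin (Module.finrank ℚ K + 1) hθ
    (by push_cast; linarith)
  have hCj : ∀ j : ℕ, ∃ Cj : ℝ, 0 ≤ Cj ∧ ∀ (w : Fin 1 → mixedSpace K) (X : mixedSpace K), ‖X‖ ≤ 1 →
      ‖iteratedFDeriv ℝ j (orb w) X‖ ≤ Cj * (1 + ‖w‖) ^ (-((Module.finrank ℚ K + 1 : ℕ) : ℝ)) := by
    intro j
    obtain ⟨Cj, hCj0, hCj⟩ := exists_norm_iteratedFDeriv_schwartz_mul_exp_le K Φinf j (Module.finrank ℚ K + 1)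
    exact ⟨Cj, hCj0, fun w X hX => by rw [horb]; exact hCj w X hX⟩
  choose Cj hCj0 hCj using hCj
  set v : ℕ → Kˣ → ℝ := fun j a => Cj j * (‖c a‖ * (1 + ‖z a‖) ^ (-((Module.finrank ℚ K + 1 : ℕ) : ℝ)))
    with hv
  have hvs : ∀ j, Summable (v j) := fun j => by
    have hs := (hA y).1
    rw [hv, hc, hz]
    exact hs.mul_left (Cj j)
  have hterms : ∀ a, ContDiff ℝ ∞ fun X => c a • orb (z a) X := fun a => (horbs (z a)).const_smul (c a)
  have hvb : ∀ (j : ℕ) (a : Kˣ) (X : mixedSpace K), ‖X‖ ≤ 1 →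
      ‖iteratedFDeriv ℝ j (fun X => c a • orb (z a) X) X‖ ≤ v j a := by
    intro j a X hX
    rw [iteratedFDeriv_const_smul_apply' ((horbs (z a)).contDiffAt.of_le (by exact_mod_cast le_top)),
      _root_.norm_smul, hv]
    calc ‖c a‖ * ‖iteratedFDeriv ℝ j (orb (z a)) X‖
        ≤ ‖c a‖ * (Cj j * (1 + ‖z a‖) ^ (-((Module.finrank ℚ K + 1 : ℕ) : ℝ))) :=
          mul_le_mul_of_nonneg_left (hCj j (z a) X hX) (norm_nonneg _)
      _ = Cj j * (‖c a‖ * (1 + ‖z a‖) ^ (-((Module.finrank ℚ K + 1 : ℕ) : ℝ))) := by ring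
  obtain ⟨hsmooth, hderiv⟩ := Literature.Analysis.Calculus.contDiffAt_tsum_and_iteratedFDeriv_eq
    one_pos hterms hvs hvb
  rw [hseries]
  refine ⟨hsmooth, fun n k hk C hC0 hC => ?_⟩
  rw [hderiv n]
  -- bound the series of derivatives at `0`
  have hθk : (Module.finrank ℚ K : ℝ) < k := by exact_mod_cast hk
  obtain ⟨A', -, hA'⟩ := exists_tsum_decay_le_rpow_ideleNorm hfin k hθk le_rfl
  have hsk := (hA' y).1
  have hbd : ∀ a : Kˣ, ‖iteratedFDeriv ℝ n (fun X => c a • orb (z a) X) 0‖ ≤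
      C * (‖c a‖ * (1 + ‖z a‖) ^ (-(k : ℝ))) := by
    intro a
    rw [iteratedFDeriv_const_smul_apply' ((horbs (z a)).contDiffAt.of_le (by exact_mod_cast le_top)),
      _root_.norm_smul]
    have h0 : ‖(0 : mixedSpace K)‖ ≤ 1 := by rw [norm_zero]; exact zero_le_one
    have h1 := hC (z a) 0 h0
    calc ‖c a‖ * ‖iteratedFDeriv ℝ n (orb (z a)) 0‖ ≤ ‖c a‖ * (C * (1 + ‖z a‖) ^ (-(k : ℝ))) := by
          refine mul_le_mul_of_nonneg_left ?_ (norm_nonneg _)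
          rw [horb]
          exact h1
      _ = C * (‖c a‖ * (1 + ‖z a‖) ^ (-(k : ℝ))) := by ring
  have hsC : Summable fun a : Kˣ => C * (‖c a‖ * (1 + ‖z a‖) ^ (-(k : ℝ))) := by
    rw [hc, hz]
    exact hsk.mul_left C
  refine (tsum_of_norm_bounded hsC.hasSum hbd).trans ?_
  rw [tsum_mul_left, hc, hz]

end Tensor

/-! ### Lemma 5.3 -/

section Main

variable {K}

/-- **Lemma 5.3 for pure tensors.** For `f = Φ_∞ ⊗ Φ_f` and `α > 1`, `Σ f · |x|^α ∈ 𝒮(C_K)`.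
[cite: Meyer2005, Lemma 5.3] -/
theorem weightMul_meyerSum_tensor_mem_ideleClassSchwartz
    (Φinf : SchwartzMap (Fin 1 → mixedSpace K) ℂ) {Φfin : (Fin 1 → FiniteAdeleRing (𝓞 K) K) → ℂ}
    (hfin : Φfin ∈ SchwartzBruhat (Fin 1 → FiniteAdeleRing (𝓞 K) K)) {α : ℝ} (hα : 1 < α) :
    weightMul K α (meyerSum K (fun x : AdeleRing (𝓞 K) K =>
      Φinf (fun _ => InfiniteAdeleRing.ringEquiv_mixedSpace K x.1) * Φfin (fun _ => x.2))) ∈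
        ideleClassSchwartz K := by
  refine weightMul_mem_ideleClassSchwartz_of_bounds ?_ (fun x => ?_) (fun n => ?_)
  · -- invariance under an open subgroup of `𝒪̂ˣ`
    obtain ⟨U₁, hU₁⟩ := exists_openSubgroup_forall_comp_mul_eq hfin
    refine ⟨U₁ ⊓ ⟨integralFiniteUnits K, isOpen_integralFiniteUnits⟩, fun u hu x => ?_⟩
    have hu₁ : u ∈ U₁ := (OpenSubgroup.mem_inf.1 hu).1
    have hu₂ : u ∈ integralFiniteUnits K := (OpenSubgroup.mem_inf.1 hu).2
    rw [weightMul_apply, weightMul_apply, classNorm_mul, classNorm_finiteUnitClass hu₂, mul_one]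
    congr 1
    obtain ⟨y, rfl⟩ := QuotientGroup.mk_surjective x
    have hmk : (QuotientGroup.mk y : IdeleClassGroup K) * finiteUnitClass K u =
        IdeleClassGroup.mk K (y * finIdele K u) := by
      rw [map_mul, finiteUnitClass_eq]
      rfl
    rw [hmk, IdeleClassGroup.mk_apply, meyerSum_mk, meyerSum_mk]
    unfold ideleSum
    refine tsum_congr fun a => ?_
    rw [Units.val_mul, ← mul_assoc]
    dsimp only
    rw [mul_finIdele_eq]
    dsimp only
    rw [hU₁ u hu₁]
  · -- smoothness at `0`
    obtain ⟨y, rfl⟩ := QuotientGroup.mk_surjective x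
    exact (contDiffAt_and_norm_iteratedFDeriv_archOrbit_meyerSum_tensor_le Φinf hfin y).1
  · -- decay of order `n`
    set d : ℕ := Module.finrank ℚ K with hd
    have hdpos : (0 : ℝ) < d := Nat.cast_pos.2 Module.finrank_pos
    set s₁ : ℝ := (1 + α) / 2 with hs₁
    set s₂ : ℝ := α + 1 with hs₂
    have hs₁1 : 1 < s₁ := by rw [hs₁]; linarith
    have hs₁α : s₁ < α := by rw [hs₁]; linarith
    set k : ℕ := ⌈s₂ * d⌉₊ + 1 with hk
    have hkd : d < k := by
      have h1 : (d : ℝ) ≤ s₂ * d := by rw [hs₂]; nlinarith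
      have h2 : s₂ * d ≤ ⌈s₂ * d⌉₊ := Nat.le_ceil _
      have h3 : (d : ℝ) < ⌈s₂ * d⌉₊ + 1 := by linarith
      exact_mod_cast h3
    have hθ₁d : (d : ℝ) < s₁ * d := by nlinarith
    have hθ₂d : (d : ℝ) < s₂ * d := by rw [hs₂]; nlinarith
    have hθ₁k : s₁ * d ≤ k := by
      have : s₁ * d ≤ s₂ * d := by rw [hs₁, hs₂]; nlinarith
      have h2 : s₂ * d ≤ ⌈s₂ * d⌉₊ := Nat.le_ceil _
      rw [hk]; push_cast; linarith
    have hθ₂k : s₂ * d ≤ k := by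
      have h2 : s₂ * d ≤ ⌈s₂ * d⌉₊ := Nat.le_ceil _
      rw [hk]; push_cast; linarith
    obtain ⟨C, hC0, hC⟩ := exists_norm_iteratedFDeriv_schwartz_mul_exp_le K Φinf n k
    obtain ⟨A₁, hA₁0, hA₁⟩ := exists_tsum_decay_le_rpow_ideleNorm hfin k hθ₁d hθ₁k
    obtain ⟨A₂, hA₂0, hA₂⟩ := exists_tsum_decay_le_rpow_ideleNorm hfin k hθ₂d hθ₂k
    refine ⟨s₁, s₂, C * A₁, C * A₂, hs₁α, by rw [hs₂]; linarith, fun x => ?_⟩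
    obtain ⟨y, rfl⟩ := QuotientGroup.mk_surjective x
    have hmain := (contDiffAt_and_norm_iteratedFDeriv_archOrbit_meyerSum_tensor_le Φinf hfin y).2
      n k hkd hC0 hC
    have hN : classNorm K (QuotientGroup.mk y : IdeleClassGroup K) = (IdeleClassGroup.ideleNorm K y : ℝ) := rfl
    have he₁ : -(s₁ * d) / (d : ℝ) = -s₁ := by field_simp
    have he₂ : -(s₂ * d) / (d : ℝ) = -s₂ := by field_simp
    constructor
    · refine hmain.trans ?_
      have h := (hA₁ y).2
      rw [he₁] at h
      rw [hN, mul_assoc]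
      exact mul_le_mul_of_nonneg_left h hC0
    · refine hmain.trans ?_
      have h := (hA₂ y).2
      rw [he₂] at h
      rw [hN, mul_assoc]
      exact mul_le_mul_of_nonneg_left h hC0

/-- `Σ` is additive on `𝒮(𝔸_K)` (absolute convergence). [cite: Meyer2005, §5.3] -/
theorem meyerSum_constVec_add_of_mem {F G : (Fin 1 → AdeleRing (𝓞 K) K) → ℂ}
    (hF : F ∈ piSchwartzBruhat K (Fin 1)) (hG : G ∈ piSchwartzBruhat K (Fin 1)) :
    meyerSum K (fun x => (F + G) fun _ : Fin 1 => x) =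
      meyerSum K (fun x => F fun _ : Fin 1 => x) + meyerSum K (fun x => G fun _ : Fin 1 => x) := by
  funext x
  obtain ⟨y, rfl⟩ := QuotientGroup.mk_surjective x
  rw [Pi.add_apply, meyerSum_mk, meyerSum_mk, meyerSum_mk]
  unfold ideleSum
  exact (summable_units_of_mem_piSchwartzBruhat hF y).tsum_add (summable_units_of_mem_piSchwartzBruhat hG y)

/-- `Σ` is homogeneous. [cite: Meyer2005, §5.3] -/
theorem meyerSum_constVec_smul (c : ℂ) (F : (Fin 1 → AdeleRing (𝓞 K) K) → ℂ) :
    meyerSum K (fun x => (c • F) fun _ : Fin 1 => x) = c • meyerSum K (fun x => F fun _ : Fin 1 => x) := by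
  funext x
  obtain ⟨y, rfl⟩ := QuotientGroup.mk_surjective x
  rw [Pi.smul_apply, meyerSum_mk, meyerSum_mk]
  unfold ideleSum
  simp only [Pi.smul_apply, smul_eq_mul]
  exact tsum_mul_left

/-- `Σ 0 = 0`. [folklore] -/
theorem meyerSum_constVec_zero :
    meyerSum K (fun x => (0 : (Fin 1 → AdeleRing (𝓞 K) K) → ℂ) fun _ : Fin 1 => x) = 0 := by
  funext x
  obtain ⟨y, rfl⟩ := QuotientGroup.mk_surjective x
  rw [Pi.zero_apply, meyerSum_mk]
  unfold ideleSum
  simp only [Pi.zero_apply, tsum_zero]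

/-- **Meyer's Lemma 5.3** (R. Meyer, Duke Math. J. 127 (2005), Lemma 5.3: "The summation map `Σ`
defines a bounded linear map from `H₊` to `𝒮(C_K)₊`", `𝒮(C_K)₊ = 𝒮(C_K)_{(1,∞)}`): for every
Bruhat–Schwartz function `f` on `𝔸_K`, `Σ f ∈ 𝒮(C_K)_{(1,∞)}`, i.e. `Σ f · |x|^α ∈ 𝒮(C_K)` for all
`α > 1`. (Only the algebraic statement; boundedness is not formalised.) [cite: Meyer2005, Lemma 5.3] -/
theorem meyerSum_mem_ideleClassSchwartzWeighted_Ioi {f : AdeleRing (𝓞 K) K → ℂ}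
    (hf : f ∈ schwartzBruhatAdele K) :
    meyerSum K f ∈ ideleClassSchwartzWeighted K (Set.Ioi 1) := by
  rw [mem_ideleClassSchwartzWeighted_iff]
  intro α hα
  rw [Set.mem_Ioi] at hα
  rw [mem_schwartzBruhatAdele_iff] at hf
  have key : ∀ F ∈ piSchwartzBruhat K (Fin 1),
      weightMul K α (meyerSum K (fun x => F fun _ : Fin 1 => x)) ∈ ideleClassSchwartz K := by
    intro F hF
    induction hF using Submodule.span_induction with
    | mem F h =>
      obtain ⟨Φinf, Φfin, hfin, rfl⟩ := h
      exact weightMul_meyerSum_tensor_mem_ideleClassSchwartz Φinf hfin hα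
    | zero =>
      rw [meyerSum_constVec_zero, map_zero]
      exact zero_mem _
    | add F G hF hG ihF ihG =>
      rw [meyerSum_constVec_add_of_mem hF hG, map_add]
      exact add_mem ihF ihG
    | smul c F _ ih =>
      rw [meyerSum_constVec_smul, map_smul]
      exact Submodule.smul_mem _ c ih
  exact key _ hf

/-- **Lemma 5.3, weighted form**: `Σ f · |x|^α ∈ 𝒮(C_K)` for `f ∈ 𝒮(𝔸_K)` and `α > 1`.
[cite: Meyer2005, Lemma 5.3] -/
theorem weightMul_meyerSum_mem_ideleClassSchwartz {f : AdeleRing (𝓞 K) K → ℂ}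
    (hf : f ∈ schwartzBruhatAdele K) {α : ℝ} (hα : 1 < α) :
    weightMul K α (meyerSum K f) ∈ ideleClassSchwartz K :=
  (mem_ideleClassSchwartzWeighted_iff.1 (meyerSum_mem_ideleClassSchwartzWeighted_Ioi hf)) α hα

end Main

end Literature.NumberTheory.Automorphic.Meyer
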